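import Literature.Combinatorics.LorentzianPolynomials.LorentzianOfLogConcave
import Mathlib.Algebra.Order.Antidiag.Finsupp
import Mathlib.Topology.Algebra.Order.LiminfLimsup
import HarnessLib

/-!
# `L^d_n` is closed; strictly Lorentzian polynomials (Def. 2.1) and their limits are Lorentzian
# (Brändén–Huh 2020, §2.1 Def. 2.1, §2.4 Theorem 2.25)

Layer `Literature/Combinatorics/LorentzianPolynomials`, namespace `Literature.Combinatorics.LorentzianPolynomials`;
lane `lit-hodgefound` (Track 2 foundations library), seat p16, generation 29 (row g29-#4). The tree's `lorentzian σ d`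
is Brändén–Huh's `L^d_n` of Definition 2.6. This file adds Definition 2.1 (`strictlyLorentzian σ d = L̊^d_n`) and
proves, for the coefficientwise topology of `H^d_n` ("the Euclidean norm for the coefficients"), the second sentence
of Theorem 2.25 — `L^d_n` is closed — and the inclusion `closure(L̊^d_n) ⊆ L^d_n` of its first sentence: every
limit of strictly Lorentzian polynomials (a "Lorentzian polynomial" in the sense of Def. 2.1) lies in `L^d_n`. The
reverse inclusion is Theorem 2.13 (the Nuij-type homotopy, Lemma 2.12), not treated here.

## Source (verbatim) — P. Brändén, J. Huh, *Lorentzian polynomials* [BrandenHuh2019] (held `paper:arxiv-1902.03719`)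

§2.1 (p. 8): "We write `H^d_n` for the set of degree `d` homogeneous polynomials in `ℝ[w_1, …, w_n]`. We define a
topology on `H^d_n` using the Euclidean norm for the coefficients, and write `P^d_n ⊆ H^d_n` for the open subset of
polynomials all of whose coefficients are positive. […] **Definition 2.1** (Lorentzian polynomials). We set
`L̊^0_n = P^0_n`, `L̊^1_n = P^1_n`, and `L̊^2_n = {f ∈ P^2_n | 𝓗_f is nonsingular and has exactly one positive
eigenvalue}`. For `d` larger than `2`, we define `L̊^d_n` recursively by setting
`L̊^d_n = {f ∈ P^d_n | ∂_i f ∈ L̊^{d-1}_n for all i ∈ [n]}`. The polynomials in `L̊^d_n` are called *strictly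
Lorentzian*, and the limits of strictly Lorentzian polynomials are called *Lorentzian*. […] Unwinding the recursive
definition, we have `L̊^d_n = {f ∈ P^d_n | ∂^α f ∈ L̊^2_n for every α ∈ Δ^{d-2}_n}`."
§2.4 (p. 24): "**Theorem 2.25.** The closure of `L̊^d_n` in `H^d_n` is `L^d_n`. In particular, `L^d_n` is a closed
subset of `H^d_n`. *Proof.* By Theorem 2.13, the closure of `L̊^d_n` contains `L^d_n`. Since any limit of `c`-Rayleigh
polynomials must be `c`-Rayleigh, the other inclusion follows from Theorem 2.23 and Proposition 2.19."

## What is here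

* §1 **Definition 2.1** `strictlyLorentzian σ d` (recursive, as printed; "nonsingular" = `det 𝓗_f ≠ 0`, "exactly one
  positive eigenvalue" = `sigPos = 1`, `P^d_n` = all degree-`d` coefficients positive), unfolding lemmas, and
  **`strictlyLorentzian_subset_lorentzian`** (`L̊^d_n ⊆ L^d_n`: a polynomial with full support `Δ^d_n` has M-convex
  support).
* §2 convergence "for the coefficients": for polynomials supported in a fixed finite set `S` of exponents (here
  `Δ^d_n = univ.finsuppAntidiag d`), every `(∂^β f)(w)` is a fixed linear combination of the coefficients
  (`eval_iterPderiv_eq_sum_of_support_subset`), hence converges along coefficientwise convergent filters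
  (`tendsto_eval_iterPderiv`).
* §3 **Theorem 2.25, second sentence: `L^d_n` is closed** (`mem_lorentzian_of_tendsto_coeff`): along a coefficientwise
  convergent net of polynomials in `L^d_n` the limit is homogeneous of degree `d` with nonnegative coefficients, and
  the Hessian inequalities of strong log-concavity (`stronglyLogConcave_of_mem_lorentzian`, row g28-#12), being
  inequalities between continuous functions of finitely many coefficients, pass to the limit — so the limit is
  Lorentzian by Theorem 2.30 (2) ⟹ (3) (`mem_lorentzian_of_stronglyLogConcave`, row g29-#3; this replaces the source's
  route "limits of `c`-Rayleigh polynomials are `c`-Rayleigh" + Thm. 2.23 + Prop. 2.19 by its Hessian equivalent,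
  both resting on Theorem 2.23). Also `isCRayleigh_of_tendsto_coeff` ("any limit of `c`-Rayleigh polynomials must be
  `c`-Rayleigh", for uniformly bounded supports).
* §4 **Theorem 2.25, `closure(L̊^d_n) ⊆ L^d_n`** (`mem_lorentzian_of_tendsto_coeff_of_strictlyLorentzian`): Lorentzian
  polynomials in the sense of Definition 2.1 belong to `L^d_n` of Definition 2.6.

One definition with body (`strictlyLorentzian`), theorems otherwise; no `sorry`, no named fact (net debt 0).
-- TODO(general form): Theorem 2.13 / Lemma 2.12 (`L^d_n ⊆ closure(L̊^d_n)`), completing Theorem 2.25.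

## References

* [BrandenHuh2019] P. Brändén, J. Huh, *Lorentzian polynomials*, Ann. of Math. (2) 192 (2020) 821–891, arXiv:1902.03719 —
  §2.1 Def. 2.1 (p. 8); §2.4 Thm. 2.25 (p. 24); §2.5 Thm. 2.30.
-/

noncomputable section

open MvPolynomial Finsupp Finset Filter Topology
open Literature.LinearAlgebra.QuadraticForm

namespace Literature.Combinatorics.LorentzianPolynomials

variable {σ : Type*} [Fintype σ] [DecidableEq σ]

/-! ## §1 Definition 2.1: strictly Lorentzian polynomials -/

section Strictly

variable (σ) in
/-- **Brändén–Huh's `L̊^d_n` (Definition 2.1), the strictly Lorentzian polynomials**: "We set `L̊^0_n = P^0_n`,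
`L̊^1_n = P^1_n`, and `L̊^2_n = {f ∈ P^2_n | 𝓗_f is nonsingular and has exactly one positive eigenvalue}`. For `d` larger
than `2`, we define `L̊^d_n` recursively by setting `L̊^d_n = {f ∈ P^d_n | ∂_i f ∈ L̊^{d-1}_n for all i ∈ [n]}`" — here
`P^d_n` = degree-`d` forms all of whose degree-`d` coefficients are positive, "nonsingular" = `det 𝓗_f ≠ 0`, and
"exactly one positive eigenvalue" = `sigPos = 1` for the form `w ↦ wᵀ 𝓗_f w`. [cite: BrandenHuh2019, §2.1
Definition 2.1 (p. 8)] -/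
def strictlyLorentzian : ℕ → Set (MvPolynomial σ ℝ)
  | 0 => {f | f.IsHomogeneous 0 ∧ ∀ α : σ →₀ ℕ, α.degree = 0 → 0 < coeff α f}
  | 1 => {f | f.IsHomogeneous 1 ∧ ∀ α : σ →₀ ℕ, α.degree = 1 → 0 < coeff α f}
  | 2 => {f | f.IsHomogeneous 2 ∧ (∀ α : σ →₀ ℕ, α.degree = 2 → 0 < coeff α f) ∧ (hessian f).det ≠ 0 ∧
      sigPos (Matrix.toBilin' (hessian f)).toQuadraticMap = 1}
  | d + 3 => {f | f.IsHomogeneous (d + 3) ∧ (∀ α : σ →₀ ℕ, α.degree = d + 3 → 0 < coeff α f) ∧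
      ∀ i, pderiv i f ∈ strictlyLorentzian (d + 2)}

/-- `L̊^0_n = P^0_n`: the positive constants. [cite: BrandenHuh2019, §2.1 Def. 2.1 (p. 8)] -/
theorem mem_strictlyLorentzian_zero {f : MvPolynomial σ ℝ} :
    f ∈ strictlyLorentzian σ 0 ↔ f.IsHomogeneous 0 ∧ ∀ α : σ →₀ ℕ, α.degree = 0 → 0 < coeff α f :=
  Iff.rfl

/-- `L̊^1_n = P^1_n`: the linear forms with positive coefficients. [cite: BrandenHuh2019, §2.1 Def. 2.1 (p. 8)] -/
theorem mem_strictlyLorentzian_one {f : MvPolynomial σ ℝ} :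
    f ∈ strictlyLorentzian σ 1 ↔ f.IsHomogeneous 1 ∧ ∀ α : σ →₀ ℕ, α.degree = 1 → 0 < coeff α f :=
  Iff.rfl

/-- `L̊^2_n = {f ∈ P^2_n | 𝓗_f is nonsingular and has exactly one positive eigenvalue}` (the symmetric matrices with
positive entries and Lorentzian signature `(+, -, …, -)`). [cite: BrandenHuh2019, §2.1 Def. 2.1 (p. 8)] -/
theorem mem_strictlyLorentzian_two {f : MvPolynomial σ ℝ} :
    f ∈ strictlyLorentzian σ 2 ↔ f.IsHomogeneous 2 ∧ (∀ α : σ →₀ ℕ, α.degree = 2 → 0 < coeff α f) ∧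
      (hessian f).det ≠ 0 ∧ sigPos (Matrix.toBilin' (hessian f)).toQuadraticMap = 1 :=
  Iff.rfl

/-- `L̊^d_n = {f ∈ P^d_n | ∂_i f ∈ L̊^{d-1}_n for all i}` for `d ≥ 3`. [cite: BrandenHuh2019, §2.1 Def. 2.1 (p. 8)] -/
theorem mem_strictlyLorentzian_add_three {d : ℕ} {f : MvPolynomial σ ℝ} :
    f ∈ strictlyLorentzian σ (d + 3) ↔ f.IsHomogeneous (d + 3) ∧ (∀ α : σ →₀ ℕ, α.degree = d + 3 → 0 < coeff α f) ∧
      ∀ i, pderiv i f ∈ strictlyLorentzian σ (d + 2) :=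
  Iff.rfl

/-- `L̊^d_n ⊆ H^d_n`. [cite: BrandenHuh2019, §2.1 Def. 2.1 (p. 8)] -/
theorem isHomogeneous_of_mem_strictlyLorentzian :
    ∀ {d : ℕ} {f : MvPolynomial σ ℝ}, f ∈ strictlyLorentzian σ d → f.IsHomogeneous d
  | 0, _, h => h.1
  | 1, _, h => h.1
  | 2, _, h => h.1
  | _ + 3, _, h => h.1

/-- `L̊^d_n ⊆ P^d_n`: all degree-`d` coefficients of a strictly Lorentzian polynomial are positive.
[cite: BrandenHuh2019, §2.1 Def. 2.1 (p. 8)] -/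
theorem coeff_pos_of_mem_strictlyLorentzian :
    ∀ {d : ℕ} {f : MvPolynomial σ ℝ}, f ∈ strictlyLorentzian σ d → ∀ α : σ →₀ ℕ, α.degree = d → 0 < coeff α f
  | 0, _, h => h.2
  | 1, _, h => h.2
  | 2, _, h => h.2.1
  | _ + 3, _, h => h.2.1

/-- For `d ≥ 3`, `f ∈ L̊^d_n ⇒ ∂_i f ∈ L̊^{d-1}_n`. [cite: BrandenHuh2019, §2.1 Def. 2.1 (p. 8)] -/
theorem pderiv_mem_strictlyLorentzian {d : ℕ} {f : MvPolynomial σ ℝ} (hf : f ∈ strictlyLorentzian σ (d + 3)) (i : σ) :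
    pderiv i f ∈ strictlyLorentzian σ (d + 2) :=
  hf.2.2 i

/-- **`L̊^d_n ⊆ L^d_n`: strictly Lorentzian polynomials are Lorentzian in the sense of Definition 2.6** (the support of a
polynomial in `P^d_n` is the whole simplex `Δ^d_n`, which is M-convex; "exactly one" implies "at most one").
[cite: BrandenHuh2019, §2.1 Def. 2.1 (p. 8); §2.2 Def. 2.6; §2.4 Thm. 2.25] -/
theorem strictlyLorentzian_subset_lorentzian : ∀ d : ℕ, strictlyLorentzian σ d ⊆ lorentzian σ d
  | 0, _, h => ⟨h.1, coeff_nonneg_of_forall_coeff_pos h.1 h.2⟩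
  | 1, _, h => ⟨h.1, coeff_nonneg_of_forall_coeff_pos h.1 h.2⟩
  | 2, _, h => by
    refine ⟨h.1, coeff_nonneg_of_forall_coeff_pos h.1 h.2.1, ?_, h.2.2.2.le⟩
    rw [support_eq_of_forall_coeff_pos h.1 h.2.1]
    exact isMConvex_setOf_degree_eq 2
  | d + 3, _, h => by
    refine ⟨h.1, coeff_nonneg_of_forall_coeff_pos h.1 h.2.1, ?_, fun i ↦
      strictlyLorentzian_subset_lorentzian (d + 2) (h.2.2 i)⟩
    rw [support_eq_of_forall_coeff_pos h.1 h.2.1]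
    exact isMConvex_setOf_degree_eq (d + 3)

/-- Sanity instance for Definition 2.1 in degree `0`: `L̊^0_n = P^0_n` consists of the positive constants.
[cite: BrandenHuh2019, §2.1 Def. 2.1 (p. 8, "`L̊^0_n = P^0_n`")] -/
theorem C_mem_strictlyLorentzian_zero_iff {c : ℝ} : (C c : MvPolynomial σ ℝ) ∈ strictlyLorentzian σ 0 ↔ 0 < c := by
  rw [mem_strictlyLorentzian_zero]
  constructor
  · rintro ⟨-, h⟩
    simpa using h 0 (map_zero _)
  · intro hc
    refine ⟨isHomogeneous_C σ c, fun α hα ↦ ?_⟩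
    rw [Finsupp.degree_eq_zero_iff] at hα
    rw [hα, coeff_zero_C]
    exact hc

/-- A strictly Lorentzian polynomial is Lorentzian (Def. 2.6). [cite: BrandenHuh2019, §2.1 Def. 2.1; §2.4 Thm. 2.25] -/
theorem mem_lorentzian_of_mem_strictlyLorentzian {d : ℕ} {f : MvPolynomial σ ℝ} (hf : f ∈ strictlyLorentzian σ d) :
    f ∈ lorentzian σ d :=
  strictlyLorentzian_subset_lorentzian d hf

end Strictly

/-! ## §2 Values of derivatives as functions of the coefficients -/

section Coefficients

omit [DecidableEq σ] in
/-- For a polynomial supported in a fixed finite set `S` of exponents, every `(∂^β f)(w)` is a fixed linear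
combination of the coefficients: `(∂^β f)(w) = Σ_{γ ∈ S} (Π_j γ_j!/(γ_j-β_j)!) · coeff_γ(f) · w^{γ-β}` ("a topology on
`H^d_n` using the Euclidean norm for the coefficients"). [cite: BrandenHuh2019, §2.1 (p. 8, the topology of `H^d_n`,
`∂^α`)] -/
theorem eval_iterPderiv_eq_sum_of_support_subset {f : MvPolynomial σ ℝ} {S : Finset (σ →₀ ℕ)} (hS : f.support ⊆ S)
    (β : σ →₀ ℕ) (w : σ → ℝ) :
    eval w (iterPderiv β f) = ∑ γ ∈ S, descFactorialProd γ β * coeff γ f * ∏ i, w i ^ (γ - β : σ →₀ ℕ) i := by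
  rw [iterPderiv, map_sum]
  rw [← Finset.sum_subset hS fun γ _ hγ ↦ by
    rw [MvPolynomial.notMem_support_iff.1 hγ, mul_zero, zero_mul]]
  refine Finset.sum_congr rfl fun γ _ ↦ ?_
  rw [eval_monomial, Finsupp.prod_fintype _ _ fun i ↦ pow_zero (w i)]

omit [DecidableEq σ] in
/-- **Coefficientwise convergence gives convergence of all `(∂^β f)(w)`** for polynomials supported in a fixed finite
set of exponents. [cite: BrandenHuh2019, §2.1 (p. 8, the topology of `H^d_n`); §2.4 Thm. 2.25 ("closed subset of
`H^d_n`")] -/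
theorem tendsto_eval_iterPderiv {ι : Type*} {l : Filter ι} {F : ι → MvPolynomial σ ℝ} {f : MvPolynomial σ ℝ}
    {S : Finset (σ →₀ ℕ)} (hF : ∀ k, (F k).support ⊆ S) (hf : f.support ⊆ S)
    (hlim : ∀ γ ∈ S, Tendsto (fun k ↦ coeff γ (F k)) l (𝓝 (coeff γ f))) (β : σ →₀ ℕ) (w : σ → ℝ) :
    Tendsto (fun k ↦ eval w (iterPderiv β (F k))) l (𝓝 (eval w (iterPderiv β f))) := by
  simp only [eval_iterPderiv_eq_sum_of_support_subset (hF _), eval_iterPderiv_eq_sum_of_support_subset hf]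
  exact tendsto_finsetSum S fun γ hγ ↦ ((hlim γ hγ).const_mul _).mul_const _

omit [DecidableEq σ] in
/-- A homogeneous polynomial of degree `d` is supported in the finite simplex `Δ^d_n = univ.finsuppAntidiag d`.
[cite: BrandenHuh2019, §2.1 (p. 8, `Δ^d_n`)] -/
theorem support_subset_finsuppAntidiag [DecidableEq σ] {f : MvPolynomial σ ℝ} {d : ℕ} (hf : f.IsHomogeneous d) :
    f.support ⊆ Finset.univ.finsuppAntidiag d := by
  intro γ hγ
  rw [Finset.mem_finsuppAntidiag]
  refine ⟨?_, Finset.subset_univ _⟩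
  have h : γ.degree = d := by
    by_contra hne
    exact (MvPolynomial.mem_support_iff.1 hγ) (hf.coeff_eq_zero hne)
  rw [← h, Finsupp.degree_eq_sum]

end Coefficients

/-! ## §3 Theorem 2.25, second sentence: `L^d_n` is closed -/

section Closed

omit [Fintype σ] [DecidableEq σ] in
/-- Along a coefficientwise convergent net of forms of degree `d`, the limit is a form of degree `d`.
[cite: BrandenHuh2019, §2.1 (p. 8, the topology of `H^d_n`)] -/
theorem isHomogeneous_of_tendsto_coeff {ι : Type*} {l : Filter ι} [l.NeBot] {F : ι → MvPolynomial σ ℝ}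
    {f : MvPolynomial σ ℝ} {d : ℕ} (hF : ∀ k, (F k).IsHomogeneous d)
    (hlim : ∀ γ : σ →₀ ℕ, Tendsto (fun k ↦ coeff γ (F k)) l (𝓝 (coeff γ f))) : f.IsHomogeneous d := by
  have e : (Finsupp.degree : (σ →₀ ℕ) →+ ℕ) = Finsupp.weight (1 : σ → ℕ) := Finsupp.degree_eq_weight_one
  intro γ hγ
  by_contra hne
  have hne' : γ.degree ≠ d := by rw [e]; exact hne
  apply hγ
  have h0 : (fun k ↦ coeff γ (F k)) = fun _ ↦ (0 : ℝ) := funext fun k ↦ (hF k).coeff_eq_zero hne'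
  have h := hlim γ
  rw [h0] at h
  exact tendsto_nhds_unique h tendsto_const_nhds

/-- **Brändén–Huh, Theorem 2.25 (second sentence): "`L^d_n` is a closed subset of `H^d_n`"** — for the topology "using
the Euclidean norm for the coefficients", i.e. coefficientwise convergence: if `F_k ∈ L^d_n` and
`coeff_γ(F_k) → coeff_γ(f)` for every `γ` (along any nontrivial filter), then `f ∈ L^d_n`. Proof: `f` is homogeneous
of degree `d` with nonnegative coefficients, and for every `α`, `w ∈ ℝ^n_{>0}`, `x`, the inequality
`g_k(w) · xᵀ H_{g_k}(w) x ≤ (∇g_k(w)·x)²`, `g_k = ∂^α F_k` (Thm. 2.30 (3) ⟹ (2)) is an inequality between fixed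
polynomial functions of the coefficients, so it passes to the limit, and Thm. 2.30 (2) ⟹ (3) (whose proof is the
source's "Theorem 2.23 and Proposition 2.19") concludes. [cite: BrandenHuh2019, §2.4 Thm. 2.25 (p. 24); §2.5 Thm.
2.30] -/
theorem mem_lorentzian_of_tendsto_coeff {ι : Type*} {l : Filter ι} [l.NeBot] {F : ι → MvPolynomial σ ℝ}
    {f : MvPolynomial σ ℝ} {d : ℕ} (hF : ∀ k, F k ∈ lorentzian σ d)
    (hlim : ∀ γ : σ →₀ ℕ, Tendsto (fun k ↦ coeff γ (F k)) l (𝓝 (coeff γ f))) : f ∈ lorentzian σ d := by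
  have hhom : f.IsHomogeneous d :=
    isHomogeneous_of_tendsto_coeff (fun k ↦ isHomogeneous_of_mem_lorentzian (hF k)) hlim
  have hnn : ∀ γ, 0 ≤ coeff γ f := fun γ ↦
    ge_of_tendsto' (hlim γ) fun k ↦ coeff_nonneg_of_mem_lorentzian (hF k) γ
  -- all the polynomials are supported in `Δ^d_n`
  set S : Finset (σ →₀ ℕ) := Finset.univ.finsuppAntidiag d with hSdef
  have hFS : ∀ k, (F k).support ⊆ S := fun k ↦ support_subset_finsuppAntidiag (isHomogeneous_of_mem_lorentzian (hF k))
  have hfS : f.support ⊆ S := support_subset_finsuppAntidiag hhom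
  have hT : ∀ (β : σ →₀ ℕ) (w : σ → ℝ),
      Tendsto (fun k ↦ eval w (iterPderiv β (F k))) l (𝓝 (eval w (iterPderiv β f))) := fun β w ↦
    tendsto_eval_iterPderiv hFS hfS (fun γ _ ↦ hlim γ) β w
  -- the Hessian inequalities of strong log-concavity pass to the limit
  refine mem_lorentzian_of_stronglyLogConcave hhom hnn fun α w hw x ↦ ?_
  have hkey : ∀ g : MvPolynomial σ ℝ, eval w (iterPderiv α g) * Matrix.toBilin' (hessianAt (iterPderiv α g) w) x x =
      eval w (iterPderiv α g) * ∑ i, ∑ j, eval w (iterPderiv (α + Finsupp.single j 1 + Finsupp.single i 1) g) *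
        x i * x j := by
    intro g
    rw [toBilin'_hessianAt_apply]
    congr 1
    refine Finset.sum_congr rfl fun i _ ↦ Finset.sum_congr rfl fun j _ ↦ ?_
    rw [hessianAt_apply, iterPderiv_add_single, iterPderiv_add_single]
  have hkey' : ∀ g : MvPolynomial σ ℝ, (∑ i, x i * eval w (pderiv i (iterPderiv α g))) ^ 2 =
      (∑ i, x i * eval w (iterPderiv (α + Finsupp.single i 1) g)) ^ 2 := by
    intro g
    congr 1
    refine Finset.sum_congr rfl fun i _ ↦ ?_
    rw [iterPderiv_add_single]
  rw [hkey, hkey']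
  have hL : Tendsto (fun k ↦ eval w (iterPderiv α (F k)) *
      ∑ i, ∑ j, eval w (iterPderiv (α + Finsupp.single j 1 + Finsupp.single i 1) (F k)) * x i * x j) l
      (𝓝 (eval w (iterPderiv α f) *
        ∑ i, ∑ j, eval w (iterPderiv (α + Finsupp.single j 1 + Finsupp.single i 1) f) * x i * x j)) :=
    (hT α w).mul (tendsto_finsetSum _ fun i _ ↦ tendsto_finsetSum _ fun j _ ↦
      ((hT _ w).mul_const _).mul_const _)
  have hR : Tendsto (fun k ↦ (∑ i, x i * eval w (iterPderiv (α + Finsupp.single i 1) (F k))) ^ 2) l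
      (𝓝 ((∑ i, x i * eval w (iterPderiv (α + Finsupp.single i 1) f)) ^ 2)) :=
    (tendsto_finsetSum _ fun i _ ↦ (hT _ w).const_mul _).pow 2
  refine le_of_tendsto_of_tendsto' hL hR fun k ↦ ?_
  rw [← hkey, ← hkey']
  exact stronglyLogConcave_of_mem_lorentzian (hF k) α (fun i ↦ (hw i).le) x

omit [DecidableEq σ] in
/-- **"Any limit of `c`-Rayleigh polynomials must be `c`-Rayleigh"** (for polynomials supported in a fixed finite set
of exponents, e.g. forms of a fixed degree): Def. 2.18 consists of inequalities between fixed polynomial functions of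
the coefficients. [cite: BrandenHuh2019, §2.4 proof of Thm. 2.25 (p. 24)] -/
theorem isCRayleigh_of_tendsto_coeff {ι : Type*} {l : Filter ι} [l.NeBot] {F : ι → MvPolynomial σ ℝ}
    {f : MvPolynomial σ ℝ} {c : ℝ} {S : Finset (σ →₀ ℕ)} (hF : ∀ k, IsCRayleigh c (F k))
    (hFS : ∀ k, (F k).support ⊆ S) (hfS : f.support ⊆ S)
    (hlim : ∀ γ : σ →₀ ℕ, Tendsto (fun k ↦ coeff γ (F k)) l (𝓝 (coeff γ f))) : IsCRayleigh c f := by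
  have hT : ∀ (β : σ →₀ ℕ) (w : σ → ℝ),
      Tendsto (fun k ↦ eval w (iterPderiv β (F k))) l (𝓝 (eval w (iterPderiv β f))) := fun β w ↦
    tendsto_eval_iterPderiv hFS hfS (fun γ _ ↦ hlim γ) β w
  refine ⟨fun γ ↦ ge_of_tendsto' (hlim γ) fun k ↦ (hF k).coeff_nonneg γ, fun α i j w hw ↦ ?_⟩
  exact le_of_tendsto_of_tendsto' ((hT α w).mul (hT _ w)) (((hT _ w).mul (hT _ w)).const_mul c)
    fun k ↦ (hF k).le α i j hw

end Closed

/-! ## §4 Theorem 2.25: limits of strictly Lorentzian polynomials lie in `L^d_n` -/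

section Closure

/-- **Brändén–Huh, Theorem 2.25 (the inclusion `closure(L̊^d_n) ⊆ L^d_n`): a limit of strictly Lorentzian polynomials —
a Lorentzian polynomial in the sense of Definition 2.1 — belongs to `L^d_n` of Definition 2.6.** ("The closure of
`L̊^d_n` in `H^d_n` is `L^d_n`"; the inclusion `L^d_n ⊆ closure(L̊^d_n)` is Theorem 2.13, not proved here.)
[cite: BrandenHuh2019, §2.4 Thm. 2.25 (p. 24); §2.1 Def. 2.1] -/
theorem mem_lorentzian_of_tendsto_coeff_of_strictlyLorentzian {ι : Type*} {l : Filter ι} [l.NeBot]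
    {F : ι → MvPolynomial σ ℝ} {f : MvPolynomial σ ℝ} {d : ℕ} (hF : ∀ k, F k ∈ strictlyLorentzian σ d)
    (hlim : ∀ γ : σ →₀ ℕ, Tendsto (fun k ↦ coeff γ (F k)) l (𝓝 (coeff γ f))) : f ∈ lorentzian σ d :=
  mem_lorentzian_of_tendsto_coeff (fun k ↦ strictlyLorentzian_subset_lorentzian d (hF k)) hlim

/-- Sequential form: the coefficientwise limit of a sequence of strictly Lorentzian polynomials is in `L^d_n`.
[cite: BrandenHuh2019, §2.1 Def. 2.1 ("the limits of strictly Lorentzian polynomials are called Lorentzian"); §2.4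
Thm. 2.25] -/
theorem mem_lorentzian_of_seq_tendsto_coeff {F : ℕ → MvPolynomial σ ℝ} {f : MvPolynomial σ ℝ} {d : ℕ}
    (hF : ∀ k, F k ∈ strictlyLorentzian σ d)
    (hlim : ∀ γ : σ →₀ ℕ, Tendsto (fun k ↦ coeff γ (F k)) atTop (𝓝 (coeff γ f))) : f ∈ lorentzian σ d :=
  mem_lorentzian_of_tendsto_coeff_of_strictlyLorentzian hF hlim

end Closure

end Literature.Combinatorics.LorentzianPolynomials

end
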